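import Mathlib.Analysis.SpecialFunctions.Pow.Real

/-!
# `BalabanUV.Beta.GAN24.BlockCubePoincare` — binder row G-an2-4 ∕ (CONV-C), routes C-R6° («VALUES») × R7 («TWO CURRENCIES»), PART 174 (file 1 ∕ 2):
# THE CUBE CALCULUS BEHIND THE BLOCK POINCARÉ INEQUALITY — on `[0,R)^d = Fin d → Fin R`, differences are controlled by single bumps (`|g(j′) − g(j)| ≤ d(R−1)·c`,
# the hybrid chain), and ONE BLOCK ABSTRACTLY: a block × contour array `F j t` with `Σ_j Σ_{t<R} F j t = 0` has `Σ_j (F j 0)² ≤ R^d·2(R−1)²·(d²·CE + LE)`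
# when its cube bumps have squares `≤ CE` and its contour steps squares `≤ LE` (unit b2b-balaban-gan24-p3, gen 59; v1)

NOT IN PRINT; OUR PROOF ([folklore]: finite-difference calculus on a discrete cube; Mathlib only — `Function.update`, `Finset.sum_range_sub`, `Real.sqrt`).  The torus half
(Bałaban's one-step averaging `QB N R M`, the Poincaré inequality on `ker (re QB)`, the kernel-coercivity corollaries in both currencies) is file 2 ∕ 2
`OneStepConstraintPoincare`, which instantiates `block_sq_sum_le` below with `F j t = u_μ(R·y + j + t·e′_μ)`.  [Balaban1984PropagatorsII] Lemma 2.4 (2.128) p. 245 and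
(2.153) ∕ (2.157) pp. 249–250 LOCATE Bałaban's own constrained lower bound (curl form, axial gauge) — nothing printed is a hypothesis here.
HONEST FRAMING (cell contract, verbatim): «discharging `BetaPertH` makes Bałaban's UV stability UNCONDITIONAL — a real constructive-QFT result; it is NOT the continuum limit
and NOT the Clay problem.»  HONEST DEPENDENCY (verbatim): «continuum YM on T⁴ ⇐ BetaPertH ∧ nine spine estimates (0/9 proved); BetaPertH ⇐ (D1) ∧ (D4) ∧ CAP+tail; G-an2-4 gates
asym, D1 and NE2/3/4.»

WHY (census V198 (d), gen 58).  The one genuinely new model-side input of the one-loop letter `𝒢_k` is a KERNEL COERCIVITY on `ker QB` (PART 169 ∕ 170 `hker`, PART 173 `hkerC`);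
a fine form that kills constants can at best dominate a GRADIENT form, and the block Poincaré inequality on `ker (re QB)` is what converts one into the other.  Its combinatorial
core is torus-free and is isolated here so that file 2 stays within one topic (and 400 lines).

THE ARGUMENT.  §1: `r` bumps in one coordinate cost `r·c` (induction on `r`); two points differing in one coordinate cost `(R−1)·c`; any two points cost `d(R−1)·c` along the
hybrid chain `h_n = (j′ on the first n coordinates, j elsewhere)`, `h_0 = j`, `h_d = j′`, consecutive members differing in one coordinate (`Finset.sum_range_sub`).
§2: with `c = √CE` (cube) and `√LE` (contour, telescoped over `t < R` steps), every `F j₀ 0` is the average over the `R^d·R` pairs `(j, t)` of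
`(F j₀ 0 − F j 0) + (F j 0 − F j t)`, so `|F j₀ 0| ≤ (R−1)(d√CE + √LE) =: K`, and `Σ_j (F j 0)² ≤ R^d K² ≤ R^d·2(R−1)²(d²CE + LE)` by `(a+b)² ≤ 2(a²+b²)`.

WHAT THIS FILE PROVES (0 sorry, 0 `def`; every `d`; every `R` in §1, `R ≥ 1` in §2):
* §1 **`abs_sub_le_of_bump_line`** (`|g(j[ν ↦ j_ν + r]) − g(j)| ≤ r·c`), **`abs_sub_le_of_update`** (`|g(j[ν ↦ b]) − g(j)| ≤ (R−1)·c`), **`abs_sub_le_cube`**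
  (`|g(j′) − g(j)| ≤ d·(R−1)·c`) — all under the single-bump hypothesis `|g(j[ν ↦ j_ν+1]) − g(j)| ≤ c` inside the cube.
* §2 **`block_sq_sum_le`** — the abstract one-block estimate displayed in the title.
WHAT IT IS NOT: no lattice, no torus, no averaging operator appears here (file 2); the constants are not optimised (the true Poincaré order is `R²`, not `R^{d+2}`).
SUPPLIER work; NEVER «G-an2-4 closed»; NOT (CONV-C), NOT D1, NOT `BetaPertH`, NOT continuum, NOT Clay.  Records: `HOME/b2b-balaban-gan24-p3/gen59/README.md`.
-/

noncomputable section

open scoped BigOperators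
open Finset

namespace Summit.QuantumFields.BalabanUV.Beta.GAN24.BlockCubePoincare

/-! ## §1 Cube calculus on `[0,R)^d`: differences controlled by single bumps -/

section Cube

variable {d R : ℕ}

/-- **`r` bumps in one coordinate**: if every single bump `j ↦ j + δ_ν` inside the cube moves `g` by at most `c`, then `r` bumps in coordinate `ν` move it by at most `r·c`.
[folklore] -/
theorem abs_sub_le_of_bump_line (g : (Fin d → Fin R) → ℝ) {c : ℝ}
    (hc : ∀ (j : Fin d → Fin R) (ν : Fin d) (h : (j ν : ℕ) + 1 < R), |g (Function.update j ν ⟨(j ν : ℕ) + 1, h⟩) - g j| ≤ c)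
    (j : Fin d → Fin R) (ν : Fin d) (r : ℕ) (h : (j ν : ℕ) + r < R) :
    |g (Function.update j ν ⟨(j ν : ℕ) + r, h⟩) - g j| ≤ r * c := by
  induction r with
  | zero =>
      have e : Function.update j ν ⟨(j ν : ℕ) + 0, h⟩ = j := by
        rw [show (⟨(j ν : ℕ) + 0, h⟩ : Fin R) = j ν from Fin.ext (by simp), Function.update_eq_self]
      rw [e, sub_self, abs_zero, Nat.cast_zero, zero_mul]
  | succ r ih =>
      have h' : (j ν : ℕ) + r < R := by omega
      set j₁ : Fin d → Fin R := Function.update j ν ⟨(j ν : ℕ) + r, h'⟩ with hj₁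
      have hν : (j₁ ν : ℕ) = (j ν : ℕ) + r := by rw [hj₁, Function.update_self]
      have h₁ : (j₁ ν : ℕ) + 1 < R := by rw [hν]; omega
      have e : Function.update j ν ⟨(j ν : ℕ) + (r + 1), h⟩ = Function.update j₁ ν ⟨(j₁ ν : ℕ) + 1, h₁⟩ := by
        funext ν'
        by_cases hν' : ν' = ν
        · subst hν'
          rw [Function.update_self, Function.update_self]
          exact Fin.ext (show (j ν' : ℕ) + (r + 1) = (j₁ ν' : ℕ) + 1 by omega)
        · rw [Function.update_of_ne hν', Function.update_of_ne hν', hj₁, Function.update_of_ne hν']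
      rw [e]
      calc |g (Function.update j₁ ν ⟨(j₁ ν : ℕ) + 1, h₁⟩) - g j|
          = |(g (Function.update j₁ ν ⟨(j₁ ν : ℕ) + 1, h₁⟩) - g j₁) + (g j₁ - g j)| := by rw [sub_add_sub_cancel]
        _ ≤ |g (Function.update j₁ ν ⟨(j₁ ν : ℕ) + 1, h₁⟩) - g j₁| + |g j₁ - g j| := abs_add_le _ _
        _ ≤ c + r * c := add_le_add (hc j₁ ν h₁) (by rw [hj₁]; exact ih h')
        _ = ((r + 1 : ℕ) : ℝ) * c := by push_cast; ring

/-- **two points differing in one coordinate**: `|g(j[ν ↦ b]) − g(j)| ≤ (R−1)·c`. [folklore] -/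
theorem abs_sub_le_of_update (g : (Fin d → Fin R) → ℝ) {c : ℝ} (hc0 : 0 ≤ c)
    (hc : ∀ (j : Fin d → Fin R) (ν : Fin d) (h : (j ν : ℕ) + 1 < R), |g (Function.update j ν ⟨(j ν : ℕ) + 1, h⟩) - g j| ≤ c)
    (j : Fin d → Fin R) (ν : Fin d) (b : Fin R) :
    |g (Function.update j ν b) - g j| ≤ ((R : ℝ) - 1) * c := by
  have hb : (b : ℕ) < R := b.isLt
  have hjν : (j ν : ℕ) < R := (j ν).isLt
  rcases le_or_gt (j ν : ℕ) (b : ℕ) with hle | hlt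
  · -- `b = j_ν + r`, `r = b − j_ν ≤ R − 1`
    set r : ℕ := (b : ℕ) - (j ν : ℕ) with hr
    have h : (j ν : ℕ) + r < R := by omega
    have e : Function.update j ν b = Function.update j ν ⟨(j ν : ℕ) + r, h⟩ := by
      congr 1; exact Fin.ext (show (b : ℕ) = (j ν : ℕ) + r by omega)
    rw [e]
    refine (abs_sub_le_of_bump_line g hc j ν r h).trans (mul_le_mul_of_nonneg_right ?_ hc0)
    have : (r : ℝ) + 1 ≤ R := by exact_mod_cast (show r + 1 ≤ R by omega)
    linarith
  · -- `j_ν = b + r`: go from `j[ν ↦ b]` back up to `j`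
    set j₀ : Fin d → Fin R := Function.update j ν b with hj₀
    set r : ℕ := (j ν : ℕ) - (b : ℕ) with hr
    have h0ν : (j₀ ν : ℕ) = (b : ℕ) := by rw [hj₀, Function.update_self]
    have h : (j₀ ν : ℕ) + r < R := by omega
    have e : j = Function.update j₀ ν ⟨(j₀ ν : ℕ) + r, h⟩ := by
      funext ν'
      by_cases hν' : ν' = ν
      · subst hν'
        rw [Function.update_self]
        exact Fin.ext (show (j ν' : ℕ) = (j₀ ν' : ℕ) + r by omega)
      · rw [Function.update_of_ne hν', hj₀, Function.update_of_ne hν']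
    rw [abs_sub_comm]
    conv_lhs => rw [e]
    refine (abs_sub_le_of_bump_line g hc j₀ ν r h).trans (mul_le_mul_of_nonneg_right ?_ hc0)
    have : (r : ℝ) + 1 ≤ R := by exact_mod_cast (show r + 1 ≤ R by omega)
    linarith

/-- **`abs_sub_le_cube` — ANY TWO POINTS OF THE CUBE**: `|g(j′) − g(j)| ≤ d·(R−1)·c` — the hybrid chain `j = h₀, h₁, …, h_d = j′` (`h_n` takes its first `n` coordinates from `j′`,
the rest from `j`) changes one coordinate at a time. [folklore] -/
theorem abs_sub_le_cube (g : (Fin d → Fin R) → ℝ) {c : ℝ} (hc0 : 0 ≤ c)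
    (hc : ∀ (j : Fin d → Fin R) (ν : Fin d) (h : (j ν : ℕ) + 1 < R), |g (Function.update j ν ⟨(j ν : ℕ) + 1, h⟩) - g j| ≤ c)
    (j j' : Fin d → Fin R) : |g j' - g j| ≤ (d : ℝ) * (((R : ℝ) - 1) * c) := by
  -- the hybrid chain
  let hyb : ℕ → (Fin d → Fin R) := fun n ν => if (ν : ℕ) < n then j' ν else j ν
  have h0 : hyb 0 = j := by
    funext ν; simp [hyb]
  have hd : hyb d = j' := by
    funext ν; simp [hyb, ν.isLt]
  have hstep : ∀ n, n < d → ∃ (ν : Fin d) (b : Fin R), hyb (n + 1) = Function.update (hyb n) ν b := by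
    intro n hn
    refine ⟨⟨n, hn⟩, j' ⟨n, hn⟩, funext fun ν => ?_⟩
    by_cases hν : ν = ⟨n, hn⟩
    · subst hν
      simp [hyb]
    · have hne : (ν : ℕ) ≠ n := fun h => hν (Fin.ext h)
      rw [Function.update_of_ne hν]
      simp only [hyb]
      by_cases hlt : (ν : ℕ) < n
      · rw [if_pos hlt, if_pos (by omega)]
      · rw [if_neg hlt, if_neg (by omega)]
  have htel : g j' - g j = ∑ n ∈ Finset.range d, (g (hyb (n + 1)) - g (hyb n)) := by
    rw [Finset.sum_range_sub (fun n => g (hyb n)), hd, h0]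
  rw [htel]
  refine (Finset.abs_sum_le_sum_abs _ _).trans ?_
  calc ∑ n ∈ Finset.range d, |g (hyb (n + 1)) - g (hyb n)|
      ≤ ∑ _n ∈ Finset.range d, ((R : ℝ) - 1) * c := by
        refine Finset.sum_le_sum fun n hn => ?_
        obtain ⟨ν, b, e⟩ := hstep n (Finset.mem_range.mp hn)
        rw [e]
        exact abs_sub_le_of_update g hc0 hc (hyb n) ν b
    _ = (d : ℝ) * (((R : ℝ) - 1) * c) := by rw [Finset.sum_const, Finset.card_range, nsmul_eq_mul]

end Cube

/-! ## §2 One block: a vanishing block × contour sum controls the block's mass by two local energies -/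

section Block

variable {d R : ℕ}

/-- **`block_sq_sum_le` — ONE BLOCK, ABSTRACTLY**: let `F j t` (`j ∈ [0,R)^d`, `t ∈ ℕ`) be a block × contour array with `Σ_j Σ_{t<R} F j t = 0` (one row of Bałaban's constraint),
whose single bumps inside the cube at `t = 0` have squares `≤ CE` and whose single contour steps `t ↦ t+1` (`t + 1 < R`) have squares `≤ LE`.  Then
`Σ_j (F j 0)² ≤ R^d · 2(R−1)² · (d²·CE + LE)`: every `F j₀ 0` is the average over `(j, t)` of `(F j₀ 0 − F j 0) + (F j 0 − F j t)`, the first difference costs `≤ d(R−1)√CE`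
(the hybrid chain, `abs_sub_le_cube`), the second `≤ (R−1)√LE` (telescoping). [folklore] -/
theorem block_sq_sum_le [NeZero R] (F : (Fin d → Fin R) → ℕ → ℝ) {CE LE : ℝ} (hCE : 0 ≤ CE) (hLE : 0 ≤ LE)
    (hrow : ∑ j : Fin d → Fin R, ∑ t : Fin R, F j (t : ℕ) = 0)
    (hcube : ∀ (j : Fin d → Fin R) (ν : Fin d) (h : (j ν : ℕ) + 1 < R), (F (Function.update j ν ⟨(j ν : ℕ) + 1, h⟩) 0 - F j 0) ^ 2 ≤ CE)
    (hline : ∀ (j : Fin d → Fin R) (s : ℕ), s + 1 < R → (F j (s + 1) - F j s) ^ 2 ≤ LE) :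
    ∑ j : Fin d → Fin R, F j 0 ^ 2 ≤ (R : ℝ) ^ d * (2 * ((R : ℝ) - 1) ^ 2 * ((d : ℝ) ^ 2 * CE + LE)) := by
  have hR : (0 : ℝ) < R := by exact_mod_cast Nat.pos_of_ne_zero (NeZero.ne R)
  have hR1 : (0 : ℝ) ≤ (R : ℝ) - 1 := by
    have : (1 : ℝ) ≤ R := by exact_mod_cast Nat.pos_of_ne_zero (NeZero.ne R)
    linarith
  -- the two Lipschitz constants
  have hc : ∀ (j : Fin d → Fin R) (ν : Fin d) (h : (j ν : ℕ) + 1 < R),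
      |(fun j => F j 0) (Function.update j ν ⟨(j ν : ℕ) + 1, h⟩) - (fun j => F j 0) j| ≤ Real.sqrt CE :=
    fun j ν h => Real.abs_le_sqrt (hcube j ν h)
  have hcubeAll : ∀ j j' : Fin d → Fin R, |F j' 0 - F j 0| ≤ (d : ℝ) * (((R : ℝ) - 1) * Real.sqrt CE) :=
    fun j j' => abs_sub_le_cube (fun j => F j 0) (Real.sqrt_nonneg CE) hc j j'
  have hlineAll : ∀ (j : Fin d → Fin R) (t : ℕ), t < R → |F j t - F j 0| ≤ ((R : ℝ) - 1) * Real.sqrt LE := by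
    intro j t ht
    have htel : F j t - F j 0 = ∑ s ∈ Finset.range t, (F j (s + 1) - F j s) := (Finset.sum_range_sub (fun s => F j s) t).symm
    rw [htel]
    refine (Finset.abs_sum_le_sum_abs _ _).trans ?_
    calc ∑ s ∈ Finset.range t, |F j (s + 1) - F j s| ≤ ∑ _s ∈ Finset.range t, Real.sqrt LE :=
          Finset.sum_le_sum fun s hs => Real.abs_le_sqrt (hline j s (by have := Finset.mem_range.mp hs; omega))
      _ = (t : ℝ) * Real.sqrt LE := by rw [Finset.sum_const, Finset.card_range, nsmul_eq_mul]
      _ ≤ ((R : ℝ) - 1) * Real.sqrt LE := by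
          refine mul_le_mul_of_nonneg_right ?_ (Real.sqrt_nonneg LE)
          have : (t : ℝ) + 1 ≤ R := by exact_mod_cast (show t + 1 ≤ R by omega)
          linarith
  -- the pointwise bound `|F j₀ 0| ≤ K`
  set K : ℝ := (d : ℝ) * (((R : ℝ) - 1) * Real.sqrt CE) + ((R : ℝ) - 1) * Real.sqrt LE with hK
  have hcard : (Finset.univ : Finset (Fin d → Fin R)).card = R ^ d := by
    rw [Finset.card_univ, Fintype.card_fun, Fintype.card_fin, Fintype.card_fin]
  have hpt : ∀ j₀ : Fin d → Fin R, |F j₀ 0| ≤ K := by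
    intro j₀
    have hsum : ∑ j : Fin d → Fin R, ∑ t : Fin R, (F j₀ 0 - F j (t : ℕ)) = (R : ℝ) ^ d * ((R : ℝ) * F j₀ 0) := by
      simp only [Finset.sum_sub_distrib, hrow, sub_zero, Finset.sum_const, Finset.card_univ, Fintype.card_fin, nsmul_eq_mul, hcard]
      push_cast
      ring
    have habs : (R : ℝ) ^ d * ((R : ℝ) * |F j₀ 0|) ≤ (R : ℝ) ^ d * ((R : ℝ) * K) := by
      calc (R : ℝ) ^ d * ((R : ℝ) * |F j₀ 0|) = |∑ j : Fin d → Fin R, ∑ t : Fin R, (F j₀ 0 - F j (t : ℕ))| := by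
            rw [hsum, abs_mul, abs_mul, abs_of_nonneg (pow_nonneg hR.le d), abs_of_nonneg hR.le]
        _ ≤ ∑ j : Fin d → Fin R, ∑ t : Fin R, |F j₀ 0 - F j (t : ℕ)| :=
            (Finset.abs_sum_le_sum_abs _ _).trans (Finset.sum_le_sum fun j _ => Finset.abs_sum_le_sum_abs _ _)
        _ ≤ ∑ _j : Fin d → Fin R, ∑ _t : Fin R, K := by
            refine Finset.sum_le_sum fun j _ => Finset.sum_le_sum fun t _ => ?_
            calc |F j₀ 0 - F j (t : ℕ)| = |(F j₀ 0 - F j 0) + (F j 0 - F j (t : ℕ))| := by rw [sub_add_sub_cancel]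
              _ ≤ |F j₀ 0 - F j 0| + |F j 0 - F j (t : ℕ)| := abs_add_le _ _
              _ ≤ (d : ℝ) * (((R : ℝ) - 1) * Real.sqrt CE) + ((R : ℝ) - 1) * Real.sqrt LE := by
                  refine add_le_add (hcubeAll j j₀) ?_
                  rw [abs_sub_comm]
                  exact hlineAll j t t.isLt
        _ = (R : ℝ) ^ d * ((R : ℝ) * K) := by
            simp only [Finset.sum_const, Finset.card_univ, Fintype.card_fin, nsmul_eq_mul, hcard]
            push_cast
            ring
    have hpos : (0 : ℝ) < (R : ℝ) ^ d * (R : ℝ) := by positivity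
    have := habs
    nlinarith [this, hpos, abs_nonneg (F j₀ 0)]
  -- square and sum
  have hK0 : 0 ≤ K := by rw [hK]; positivity
  have hK2 : K ^ 2 ≤ 2 * ((R : ℝ) - 1) ^ 2 * ((d : ℝ) ^ 2 * CE + LE) := by
    have e : K = ((R : ℝ) - 1) * ((d : ℝ) * Real.sqrt CE + Real.sqrt LE) := by rw [hK]; ring
    rw [e, mul_pow]
    have h2 : ((d : ℝ) * Real.sqrt CE + Real.sqrt LE) ^ 2 ≤ 2 * ((d : ℝ) ^ 2 * CE + LE) := by
      have h := sq_nonneg ((d : ℝ) * Real.sqrt CE - Real.sqrt LE)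
      rw [sub_sq, mul_pow, Real.sq_sqrt hCE, Real.sq_sqrt hLE] at h
      rw [add_sq, mul_pow, Real.sq_sqrt hCE, Real.sq_sqrt hLE]
      linarith
    calc ((R : ℝ) - 1) ^ 2 * ((d : ℝ) * Real.sqrt CE + Real.sqrt LE) ^ 2 ≤ ((R : ℝ) - 1) ^ 2 * (2 * ((d : ℝ) ^ 2 * CE + LE)) :=
          mul_le_mul_of_nonneg_left h2 (sq_nonneg _)
      _ = 2 * ((R : ℝ) - 1) ^ 2 * ((d : ℝ) ^ 2 * CE + LE) := by ring
  calc ∑ j : Fin d → Fin R, F j 0 ^ 2 ≤ ∑ _j : Fin d → Fin R, K ^ 2 := by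
        refine Finset.sum_le_sum fun j _ => ?_
        rw [← sq_abs]
        exact pow_le_pow_left₀ (abs_nonneg _) (hpt j) 2
    _ = (R : ℝ) ^ d * K ^ 2 := by
        rw [Finset.sum_const, hcard, nsmul_eq_mul]; push_cast; ring
    _ ≤ (R : ℝ) ^ d * (2 * ((R : ℝ) - 1) ^ 2 * ((d : ℝ) ^ 2 * CE + LE)) := mul_le_mul_of_nonneg_left hK2 (pow_nonneg hR.le d)

end Block

end Summit.QuantumFields.BalabanUV.Beta.GAN24.BlockCubePoincare

end
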